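import Summits.BirchSwinnertonDyer.BirchSwinnertonDyer.Theorems.ResidualThetaTransportAtTwoSignedMuSeedAtTwoPlusPrimTowerGap
import Summits.BirchSwinnertonDyer.BirchSwinnertonDyer.Theorems.ResidualThetaTransportAtTwoSignedMuPropagationAtTwoRSel2Transfer
import Summits.BirchSwinnertonDyer.BirchSwinnertonDyer.Theorems.ResidualThetaTransportAtTwoSignedMuVanishingAtTwoPlusLineV42
import HarnessLib

/-!
# Line `norm-one-torus` of the crux `SignedMuSeedAtTwoPlus` (stmt-BirchSwinnertonDyer-21438) REDUCED TO ITS CERTIFICATE STUB: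
# with S1 (`primTowerGap`, p606229) and S2 (primitive ⇒ member; `Sel2TransferAtTwo` one-curve dévissage) in the kernel, the
# seed child — and with the analytic child 21437 the crux
# Kμ⁺ `SignedMuVanishingAtTwoPlus` (stmt-BirchSwinnertonDyer-20689) — follow BY NAME from the member-free layer certificates
# S3 alone; and ONE certificate at ONE curve already gives Greenberg's conjecture (μ⁺ = 0 ∧ torsion) for that curve
# (width seat bsd-wall-rtt-p4-w3 g6; `--supports stmt-BirchSwinnertonDyer-21438`; closes nothing)

HONEST FRAMING. THEOREMS ONLY (no `def`, no named fact, no `sorry`); every hypothesis is displayed; the certificate statement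
S3 (`stub_primCertificate` of `Cruxes/SignedMuSeedAtTwoPlus/Lines/norm_one_torus.lean`, sha b593f1fbe717) is OPEN as a `∀`
(conjecture-strength: residual `μ`-triviality of the irreducible supersingular `ρ̄ = W[2]` in its primitive signed-plus form)
and is a finite unit/class-group computation per class; nothing about any particular curve is asserted; BSD is not proved by
any of this.

* `§1` `isTorsion_and_mu_eq_zero_of_primCertificate` — PER CURVE, PER `(κ, γ)`: for a globally minimal `W/ℚ` good
  supersingular at `2` with `Δ_W < 0`, a cyclotomic `κ` with topological generator `γ`, ONE exponent `q` and ONE finite set of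
  fewer than `2^q` classes exhausting `R[T^q]` (`R` = the primitive residual signed-plus set of `W[2^∞][2]` over `ℚ_∞`,
  `T = conj_γ − 1`) force: every finitely generated `+` signed Selmer dual of `W` at `(κ, γ)` is `Λ`-torsion with `μ = 0`
  (S1 `primTowerGap` ⟹ `R` finite; S2 = `Sel2TransferAtTwo.residualSharp_finite_of_residualSharp_empty_finite` +
  `sel2Finite_of_residualSharp_finite` at the bad places of `W` ⟹ `Sel⁺(W/ℚ_∞)[2]` finite;
  `isTorsion_and_mu_eq_zero_iff_finite_selmer_pTorsion`). No `¬ W.HasCM`, `a₂ = 0` or analytic-rank hypothesis is used.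
* `§2` `signedMuSeedAtTwoPlus_of_primCertificates` — the child 21438 `SignedMuSeedAtTwoPlus` BY NAME from S3 alone (`A := W`,
  `e := AddEquiv.refl`; the line's composition `SignedMuSeedAtTwoPlus_of` with its first two arguments discharged).
* `§3` `signedMuVanishingAtTwoPlus_of_primCertificates_of_analytic` — the crux Kμ⁺ BY NAME from S3 and the analytic child 21437
  `SignedMuAnalyticAtTwoPlus` (`signedMuVanishingAtTwoPlus_of_analytic_of_seed`, p585569).

References: [Fukuda1994] Thm. 1; [GreenbergVatsal2000] p. 3, §2, Prop. (2.8); [BDKim2009] Prop. 2.10; [Kobayashi2003] Def. 1.1;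
[GreenbergLNM1716] §1.
-/

set_option autoImplicit false
-- D-0017: single-problem summit, so `Summit.BirchSwinnertonDyer.BirchSwinnertonDyer.…` repeats a namespace BY DESIGN.
set_option linter.dupNamespace false

noncomputable section

open scoped Classical AddSubgroup

open WeierstrassCurve NumberField IsDedekindDomain Literature Literature.NumberTheory.EllipticCurves
  Literature.NumberTheory.GaloisRepresentations Literature.NumberTheory.EllipticCurves.Kobayashi2003 ZpExtension
  Literature.NumberTheory.EllipticCurves.GreenbergVatsal2000 Literature.NumberTheory.EllipticCurves.GreenbergSelmer
  Literature.NumberTheory.EllipticCurves.Rank1Residual Literature.NumberTheory.EllipticCurves.IwasawaAlgebra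
  Summit.BirchSwinnertonDyer.BirchSwinnertonDyer.Theses.ResidualThetaTransportAtTwo
  Summit.BirchSwinnertonDyer.BirchSwinnertonDyer.Theorems.SignedTransportAtTwo
  Summit.BirchSwinnertonDyer.BirchSwinnertonDyer.Theorems.Sel2TransferAtTwo

namespace Summit.BirchSwinnertonDyer.BirchSwinnertonDyer.Theorems.SignedMuAtTwo.NormOneTorus

/-! ## §1. One certificate at one curve ⟹ Greenberg's conjecture (`+`, at `2`) for that curve at `(κ, γ)` -/

/-- **Per-curve door.** For `W/ℚ` globally minimal, good supersingular at `2`, with `Δ_W < 0`, a cyclotomic `ℤ₂`-extension `κ`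
with topological generator `γ`: if for some `q` the `T^q`-torsion (`T = conj_γ − 1`) of the PRIMITIVE residual signed-plus set of
`W[2^∞][2]` over `ℚ_∞` is a finite set of fewer than `2^q` classes, then every finitely generated `+` signed Selmer dual `X` of
`W` at `(κ, γ)` is `Λ`-torsion with `μ(X) = 0`. Chain: tower gap (S1) ⟹ primitive set finite ⟹ (S2) `Sel⁺(W/ℚ_∞)[2]` finite ⟹
(`X/2X` finite, Pontryagin + Nakayama) torsion ∧ `μ = 0`. [cite: Fukuda1994, Thm. 1] [cite: GreenbergVatsal2000, p. 3 and Prop. (2.8)]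
[cite: Kobayashi2003, Def. 1.1] -/
theorem isTorsion_and_mu_eq_zero_of_primCertificate (W : WeierstrassCurve ℚ) [W.IsElliptic] [W.IsGloballyMinimal]
    (hss : GoodSS W 2) (hΔ : W.Δ < 0) (κ : ZpExtension ℚ 2) (γ : Field.absoluteGaloisGroup ℚ)
    (hκ : κ.IsCyclotomic) (hγ : κ.IsTopGenerator γ) (q : ℕ) (hq : 1 ≤ q)
    (hcert : ∃ F : Finset (subgroupH1 κ.kerSubgroup ↥((↥(W.geomPrimaryTorsion 2))[(2 : ℤ)])),
        (∀ c, c ∈ F ↔ (c ∈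
          {c : subgroupH1 κ.kerSubgroup ↥((↥(W.geomPrimaryTorsion 2))[(2 : ℤ)]) |
            c ∈ unramifiedOutside κ.kerSubgroup ↥((↥(W.geomPrimaryTorsion 2))[(2 : ℤ)]) 2
                  (∅ : Set (HeightOneSpectrum (𝓞 ℚ))) ∧
              (∀ (w : InfinitePlace ℚ) (σ : Field.absoluteGaloisGroup ℚ),
                Literature.NumberTheory.EllipticCurves.conjH1 κ.kerSubgroup ↥((↥(W.geomPrimaryTorsion 2))[(2 : ℤ)]) σ c ∈
                  GreenbergSelmer.infKer κ.kerSubgroup ↥((↥(W.geomPrimaryTorsion 2))[(2 : ℤ)]) w) ∧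
              (∀ (v : HeightOneSpectrum (𝓞 ℚ)), ((2 : ℕ) : 𝓞 ℚ) ∈ v.asIdeal → ∀ σ : Field.absoluteGaloisGroup ℚ,
                W.conjH1 2 κ.kerSubgroup σ
                    (pushH1 κ.kerSubgroup ((↥(W.geomPrimaryTorsion 2))[(2 : ℤ)]).subtype (subtype_torsionBy_smul W 2) c) ∈
                  localKummerOverOfEmb W 2 κ.kerSubgroup (closureEmb (K := ℚ) (v.adicCompletion ℚ))
                    (⨆ n : ℕ, signedLocalPoints κ (v.adicCompletion ℚ) W 1 n))} ∧
          ((@HSub.hSub (AddMonoid.End (subgroupH1 κ.kerSubgroup ↥((↥(W.geomPrimaryTorsion 2))[(2 : ℤ)])))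
              (AddMonoid.End (subgroupH1 κ.kerSubgroup ↥((↥(W.geomPrimaryTorsion 2))[(2 : ℤ)])))
              (AddMonoid.End (subgroupH1 κ.kerSubgroup ↥((↥(W.geomPrimaryTorsion 2))[(2 : ℤ)]))) instHSub
              (Literature.NumberTheory.EllipticCurves.conjH1 κ.kerSubgroup ↥((↥(W.geomPrimaryTorsion 2))[(2 : ℤ)]) γ) 1) ^
            q) c = 0)) ∧
        F.card < 2 ^ q)
    (D : SignedSelmerDualData W κ γ 1) [Module.Finite (IwasawaAlgebra 2) D.X] :
    Module.IsTorsion (IwasawaAlgebra 2) D.X ∧ D.mu = 0 := by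
  -- S1: the primitive residual signed-plus set is finite
  have hprim := primTowerGap W κ γ hκ hγ q hq hcert
  -- S2: `S₀` := the bad places of `W` (finite, odd); `R♯_∅(W)` finite ⟹ `R♯_{S₀}(W)` finite ⟹ `Sel⁺(W/ℚ_∞)[2]` finite
  have hbad : (W.badPlaces (𝓞 ℚ)).Finite := WeierstrassCurve.finite_badPlaces_holds (𝓞 ℚ) W
  have hSW : ∀ v : HeightOneSpectrum (𝓞 ℚ), ¬ W.HasGoodReductionAt v → v ∈ hbad.toFinset := fun v hv ↦ by
    rw [Set.Finite.mem_toFinset]; exact hv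
  have hS2 : ∀ v ∈ hbad.toFinset, ((2 : ℕ) : 𝓞 ℚ) ∉ v.asIdeal := by
    intro v hv h2
    rw [Set.Finite.mem_toFinset] at hv
    exact hv (W.hasGoodReductionAt_of_hasGoodReductionAtPrime v h2 hss.1)
  have hsel2 : {s : signedSelmerInfty W κ 1 | 2 • s = 0}.Finite :=
    sel2Finite_of_residualSharp_finite W hΔ κ hbad.toFinset hSW
      (residualSharp_finite_of_residualSharp_empty_finite W κ hκ hbad.toFinset hS2 hprim)
  -- torsion ∧ `μ = 0` (`X/2X` finite)
  exact (isTorsion_and_mu_eq_zero_iff_finite_selmer_pTorsion D).mpr hsel2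

/-! ## §2. The seed child 21438 from the certificates alone -/

/-- **`SignedMuSeedAtTwoPlus` ⟸ S3.** If every habitat⁺ curve `W` (non-CM, analytic rank `0`, good supersingular at `2` with
`a₂ = 0`, `Δ_W < 0`) admits, at every cyclotomic `(κ, γ)`, a member-free layer certificate `#R[T^q] < 2^q` for some `q ≥ 1`
(`stub_primCertificate` of line `norm-one-torus`, verbatim with the line's local definitions unfolded), then the `μ`-seed child
`SignedMuSeedAtTwoPlus` holds (with `A := W`). The line's composition `SignedMuSeedAtTwoPlus_of` with S1 (`primTowerGap`,
p606229) and S2 (primitive ⇒ member) discharged. [cite: Fukuda1994, Thm. 1] [cite: GreenbergVatsal2000, p. 3 and Prop. (2.8)]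
[cite: Kobayashi2003, Def. 1.1] -/
theorem signedMuSeedAtTwoPlus_of_primCertificates
    (hcert : ∀ (W : WeierstrassCurve ℚ) [W.IsElliptic] [W.IsGloballyMinimal], ¬ W.HasCM → W.analyticRank = 0 →
      GoodSS W 2 → W.frobeniusTrace 2 = 0 → W.Δ < 0 →
      ∀ (κ : ZpExtension ℚ 2) (γ : Field.absoluteGaloisGroup ℚ), κ.IsCyclotomic → κ.IsTopGenerator γ →
      ∃ q : ℕ, 1 ≤ q ∧
        ∃ F : Finset (subgroupH1 κ.kerSubgroup ↥((↥(W.geomPrimaryTorsion 2))[(2 : ℤ)])),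
          (∀ c, c ∈ F ↔ (c ∈
            {c : subgroupH1 κ.kerSubgroup ↥((↥(W.geomPrimaryTorsion 2))[(2 : ℤ)]) |
              c ∈ unramifiedOutside κ.kerSubgroup ↥((↥(W.geomPrimaryTorsion 2))[(2 : ℤ)]) 2
                    (∅ : Set (HeightOneSpectrum (𝓞 ℚ))) ∧
                (∀ (w : InfinitePlace ℚ) (σ : Field.absoluteGaloisGroup ℚ),
                  Literature.NumberTheory.EllipticCurves.conjH1 κ.kerSubgroup ↥((↥(W.geomPrimaryTorsion 2))[(2 : ℤ)]) σ c ∈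
                    GreenbergSelmer.infKer κ.kerSubgroup ↥((↥(W.geomPrimaryTorsion 2))[(2 : ℤ)]) w) ∧
                (∀ (v : HeightOneSpectrum (𝓞 ℚ)), ((2 : ℕ) : 𝓞 ℚ) ∈ v.asIdeal → ∀ σ : Field.absoluteGaloisGroup ℚ,
                  W.conjH1 2 κ.kerSubgroup σ
                      (pushH1 κ.kerSubgroup ((↥(W.geomPrimaryTorsion 2))[(2 : ℤ)]).subtype (subtype_torsionBy_smul W 2) c) ∈
                    localKummerOverOfEmb W 2 κ.kerSubgroup (closureEmb (K := ℚ) (v.adicCompletion ℚ))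
                      (⨆ n : ℕ, signedLocalPoints κ (v.adicCompletion ℚ) W 1 n))} ∧
            ((@HSub.hSub (AddMonoid.End (subgroupH1 κ.kerSubgroup ↥((↥(W.geomPrimaryTorsion 2))[(2 : ℤ)])))
                (AddMonoid.End (subgroupH1 κ.kerSubgroup ↥((↥(W.geomPrimaryTorsion 2))[(2 : ℤ)])))
                (AddMonoid.End (subgroupH1 κ.kerSubgroup ↥((↥(W.geomPrimaryTorsion 2))[(2 : ℤ)]))) instHSub
                (Literature.NumberTheory.EllipticCurves.conjH1 κ.kerSubgroup ↥((↥(W.geomPrimaryTorsion 2))[(2 : ℤ)]) γ) 1) ^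
              q) c = 0)) ∧
          F.card < 2 ^ q) :
    SignedMuSeedAtTwoPlus := by
  intro W _ _ hCM hr hss ha2 hΔ
  refine ⟨W, ‹_›, ‹_›, hss, ha2, ⟨AddEquiv.refl _, fun _ _ ↦ rfl⟩, ?_⟩
  intro κ γ hκ hγ D _
  obtain ⟨q, hq, hc⟩ := hcert W hCM hr hss ha2 hΔ κ γ hκ hγ
  exact isTorsion_and_mu_eq_zero_of_primCertificate W hss hΔ κ γ hκ hγ q hq hc D

/-! ## §3. The crux Kμ⁺ from the certificates and the analytic child -/

/-- **`SignedMuVanishingAtTwoPlus` ⟸ S3 ∧ 21437.** The crux Kμ⁺ BY NAME from the member-free layer certificates (S3 of line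
`norm-one-torus`, conjecture-strength as a `∀`, a finite computation per class) and the analytic child `SignedMuAnalyticAtTwoPlus`
(stmt-BirchSwinnertonDyer-21437; itself ⟸ Abbes–Ullmo ∧ `CuspSpanEvenAtTwo N` for all odd `N`, p593268/p595221), through
`signedMuVanishingAtTwoPlus_of_analytic_of_seed` (p585569). [cite: GreenbergVatsal2000, p. 3 and Prop. (2.8)] [cite: Pollack2003, Prop. 6.18] -/
theorem signedMuVanishingAtTwoPlus_of_primCertificates_of_analytic
    (hcert : ∀ (W : WeierstrassCurve ℚ) [W.IsElliptic] [W.IsGloballyMinimal], ¬ W.HasCM → W.analyticRank = 0 →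
      GoodSS W 2 → W.frobeniusTrace 2 = 0 → W.Δ < 0 →
      ∀ (κ : ZpExtension ℚ 2) (γ : Field.absoluteGaloisGroup ℚ), κ.IsCyclotomic → κ.IsTopGenerator γ →
      ∃ q : ℕ, 1 ≤ q ∧
        ∃ F : Finset (subgroupH1 κ.kerSubgroup ↥((↥(W.geomPrimaryTorsion 2))[(2 : ℤ)])),
          (∀ c, c ∈ F ↔ (c ∈
            {c : subgroupH1 κ.kerSubgroup ↥((↥(W.geomPrimaryTorsion 2))[(2 : ℤ)]) |
              c ∈ unramifiedOutside κ.kerSubgroup ↥((↥(W.geomPrimaryTorsion 2))[(2 : ℤ)]) 2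
                    (∅ : Set (HeightOneSpectrum (𝓞 ℚ))) ∧
                (∀ (w : InfinitePlace ℚ) (σ : Field.absoluteGaloisGroup ℚ),
                  Literature.NumberTheory.EllipticCurves.conjH1 κ.kerSubgroup ↥((↥(W.geomPrimaryTorsion 2))[(2 : ℤ)]) σ c ∈
                    GreenbergSelmer.infKer κ.kerSubgroup ↥((↥(W.geomPrimaryTorsion 2))[(2 : ℤ)]) w) ∧
                (∀ (v : HeightOneSpectrum (𝓞 ℚ)), ((2 : ℕ) : 𝓞 ℚ) ∈ v.asIdeal → ∀ σ : Field.absoluteGaloisGroup ℚ,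
                  W.conjH1 2 κ.kerSubgroup σ
                      (pushH1 κ.kerSubgroup ((↥(W.geomPrimaryTorsion 2))[(2 : ℤ)]).subtype (subtype_torsionBy_smul W 2) c) ∈
                    localKummerOverOfEmb W 2 κ.kerSubgroup (closureEmb (K := ℚ) (v.adicCompletion ℚ))
                      (⨆ n : ℕ, signedLocalPoints κ (v.adicCompletion ℚ) W 1 n))} ∧
            ((@HSub.hSub (AddMonoid.End (subgroupH1 κ.kerSubgroup ↥((↥(W.geomPrimaryTorsion 2))[(2 : ℤ)])))
                (AddMonoid.End (subgroupH1 κ.kerSubgroup ↥((↥(W.geomPrimaryTorsion 2))[(2 : ℤ)])))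
                (AddMonoid.End (subgroupH1 κ.kerSubgroup ↥((↥(W.geomPrimaryTorsion 2))[(2 : ℤ)]))) instHSub
                (Literature.NumberTheory.EllipticCurves.conjH1 κ.kerSubgroup ↥((↥(W.geomPrimaryTorsion 2))[(2 : ℤ)]) γ) 1) ^
              q) c = 0)) ∧
          F.card < 2 ^ q)
    (hAn : SignedMuAnalyticAtTwoPlus) : SignedMuVanishingAtTwoPlus :=
  signedMuVanishingAtTwoPlus_of_analytic_of_seed hAn (signedMuSeedAtTwoPlus_of_primCertificates hcert)

end Summit.BirchSwinnertonDyer.BirchSwinnertonDyer.Theorems.SignedMuAtTwo.NormOneTorus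

end
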